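import Literature.NumberTheory.LFunctions.DeuringHeilbronnFamily
import Literature.NumberTheory.LFunctions.DeuringHeilbronnBounds
import Literature.Analysis.Complex.OneSidedPowerSumTsum
import HarnessLib

/-!
# The Deuring–Heilbronn phenomenon for the `L`-functions of class group characters

Topic `Literature/NumberTheory/LFunctions` (namespace `Literature.NumberTheory.LFunctions.NumberField`).
Everything here is PROVED; `DH.famWt`, `DH.famNode`, `DH.famPt`, `DH.famZ` are definitions with bodies (the
four-character node family).

**Theorem** (`deuringHeilbronn`; [cite: ThornerZaman2017, Theorem 1.3 / §7.2] for the Hilbert class field,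
[cite: LagariasMontgomeryOdlyzko1979, Theorem 5.1]).  There is an absolute constant `C > 0` such that for
every number field `K` (degree `n_K`, discriminant `d_K`), every REAL class group character `χ₁` (`χ₁² = 1`,
possibly trivial) with a real zero `β₁ ∈ (0, 1)` of `L(s, χ₁)`, every class group character `χ` and every
zero `ρ = β + iγ` of `L(s, χ)` with `β ≥ 1/2`, `ρ ≠ 1`, `ρ ≠ β₁`:

  `1 − β ≥ log( 1 / (C ℒ (1 − β₁)) ) / (C ℒ)`,  `ℒ = log|d_K| + n_K (log(|γ| + 2) + 1)`.

Proof (LMO / Thorner–Zaman §7.2, pair form): at `σ = 2`, `s = 2 + iγ` the characters `1, χ₁` (at `σ`) and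
`χ, χ₁χ` (at `s`) give (`hasSum_pair`) a summable node family with `Re Σ_j b_j z_j^m =
2(δ₀+δ₁)Re((σ−1)^{−2m} − (σ−β₁)^{−2m}) + 2(δ₂+δ₃)Re((s−1)^{−2m} − (s−β₁)^{−2m}) − Σ_i Re P_{2m−1} ≤ 16 m (1 − β₁)`
(`re_pairLSeries_sum_nonneg`, `re_inv_pow_sub_inv_pow_le`); the one-sided power sum inequality
(`PowerSum.exists_re_tsum_powerSum_ge`) gives `m ≤ 13 M` with `Re Σ ≥ (2 − β)^{−2m}/106`, `M ≤ (9/4) C₁ ℒ`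
(`tsum_pairWt_mul_norm_le`, `exists_re_pole_gamma_le`); `dh_final_step` concludes.

## References

* J. Thorner, A. Zaman, Algebra Number Theory 11 (2017), Thm. 1.3, §7 (arXiv:1604.01750). [ThornerZaman2017]
* J. C. Lagarias, H. L. Montgomery, A. M. Odlyzko, Invent. Math. 54 (1979), Thm. 5.1. [LagariasMontgomeryOdlyzko1979]
-/

noncomputable section

open scoped NumberField
open Complex Filter Topology Set NumberField NumberField.InfinitePlace Classical

namespace Literature.NumberTheory.LFunctions.NumberField

open Literature.NumberTheory.LFunctions.Stark1974 Literature.Analysis.Complex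

namespace DH

variable {K : Type*} [Field K] [NumberField K]

omit [NumberField K] in
/-- `χ⁻¹ = χ` for a real character. [folklore] -/
theorem inv_eq_self_of_mul_self {χ : ClassGroup (𝓞 K) →* ℂˣ} (h : χ * χ = 1) : χ⁻¹ = χ := by
  refine MonoidHom.ext fun C ↦ ?_
  have hC : χ C * χ C = 1 := by rw [← MonoidHom.mul_apply, h, MonoidHom.one_apply]
  rw [MonoidHom.inv_apply, inv_eq_of_mul_eq_one_left hC]

omit [NumberField K] in
/-- `χ₁ χ = 1` with `χ₁² = 1` forces `χ = χ₁`. [folklore] -/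
theorem eq_of_mul_eq_one_of_mul_self {χ₁ χ : ClassGroup (𝓞 K) →* ℂˣ} (h₁ : χ₁ * χ₁ = 1) (h : χ₁ * χ = 1) :
    χ = χ₁ := by
  refine MonoidHom.ext fun C ↦ ?_
  have hC : χ₁ C * χ C = 1 := by rw [← MonoidHom.mul_apply, h, MonoidHom.one_apply]
  have h1C : χ₁ C * χ₁ C = 1 := by rw [← MonoidHom.mul_apply, h₁, MonoidHom.one_apply]
  calc χ C = (χ₁ C)⁻¹ := eq_inv_of_mul_eq_one_right hC
    _ = χ₁ C := inv_eq_of_mul_eq_one_left h1C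

omit [NumberField K] in
/-- `χ · 1 = χ`. [folklore] -/
theorem mul_one_char (χ : ClassGroup (𝓞 K) →* ℂˣ) : χ * 1 = χ := MonoidHom.ext fun C ↦ by simp

/-- For the real character `χ₁` with `L(β₁, χ₁) = 0`, `0 < β₁`, `β₁ ≠ 1`: `β₁` is a multiple zero of
`Ξ_{χ₁} = ξ(χ₁)²`. [folklore] -/
theorem classXiPair_double_of_real {χ₁ : ClassGroup (𝓞 K) →* ℂˣ} (h₁ : χ₁ * χ₁ = 1) {β₁ : ℝ} (h0 : 0 < β₁)
    (h1 : β₁ ≠ 1) (hβ : classGroupLFunction K χ₁ β₁ = 0) :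
    classXiPair K χ₁ β₁ = 0 ∧ deriv (classXiPair K χ₁) β₁ = 0 :=
  classXiPair_eq_zero_of_real (inv_eq_self_of_mul_self h₁)
    (classXi_eq_zero_of_classGroupLFunction_eq_zero χ₁ (by simpa using h0)
      (by exact_mod_cast h1) hβ)

omit [Field K] [NumberField K] in
/-- `((x²)⁻¹)^m = (x^{2m})⁻¹`. [folklore] -/
theorem inv_sq_pow (x : ℂ) (m : ℕ) : ((x ^ 2)⁻¹) ^ m = (x ^ (2 * m))⁻¹ := by
  rw [inv_pow, ← pow_mul]

/-! ### The four-character family -/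

section fam

variable {ψ₀ ψ₁ ψ₂ ψ₃ : ClassGroup (𝓞 K) →* ℂˣ}
  (D₀ : SymmHadamardData (classXiPair K ψ₀)) (D₁ : SymmHadamardData (classXiPair K ψ₁))
  (D₂ : SymmHadamardData (classXiPair K ψ₂)) (D₃ : SymmHadamardData (classXiPair K ψ₃)) {β : ℂ}
  (R₀ : Removal D₀ β (ψ₁ = 1)) (R₁ : Removal D₁ β (ψ₀ = 1))
  (R₂ : Removal D₂ β (ψ₃ = 1)) (R₃ : Removal D₃ β (ψ₂ = 1)) (p q : ℂ)

/-- The weights of the family `(ψ₀, ψ₁ at p) ⊕ (ψ₂, ψ₃ at q)`. [cite: ThornerZaman2017, §7.2 (7.8)] -/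
def famWt : (SlotIdx ⊕ SlotIdx) ⊕ (SlotIdx ⊕ SlotIdx) → ℝ :=
  Sum.elim (pairWt D₀ D₁ R₀ R₁) (pairWt D₂ D₃ R₂ R₃)

omit R₀ R₁ R₂ R₃ in
/-- The nodes of the family. [cite: ThornerZaman2017, §7.2 (7.8)] -/
def famNode : (SlotIdx ⊕ SlotIdx) ⊕ (SlotIdx ⊕ SlotIdx) → ℂ :=
  Sum.elim (pairNode D₀ D₁) (pairNode D₂ D₃)

/-- The evaluation points of the family: `p` for the first pair, `q` for the second. [folklore] -/
def famPt (p q : ℂ) : (SlotIdx ⊕ SlotIdx) ⊕ (SlotIdx ⊕ SlotIdx) → ℂ :=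
  Sum.elim (fun _ ↦ p) (fun _ ↦ q)

omit R₀ R₁ R₂ R₃ in
/-- `z_j = (point − node)^{−2}`. [cite: ThornerZaman2017, §7.2 (7.8)] -/
def famZ (j : (SlotIdx ⊕ SlotIdx) ⊕ (SlotIdx ⊕ SlotIdx)) : ℂ := ((famPt p q j - famNode D₀ D₁ D₂ D₃ j) ^ 2)⁻¹

/-- The weights are `≥ 0`, and `≥ 1` when positive. [folklore] -/
theorem famWt_nonneg_and (j : (SlotIdx ⊕ SlotIdx) ⊕ (SlotIdx ⊕ SlotIdx)) :
    0 ≤ famWt D₀ D₁ D₂ D₃ R₀ R₁ R₂ R₃ j ∧ (0 < famWt D₀ D₁ D₂ D₃ R₀ R₁ R₂ R₃ j → 1 ≤ famWt D₀ D₁ D₂ D₃ R₀ R₁ R₂ R₃ j) := by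
  rcases j with j | j
  · exact ⟨pairWt_nonneg D₀ D₁ R₀ R₁ j, one_le_pairWt_of_pos D₀ D₁ R₀ R₁⟩
  · exact ⟨pairWt_nonneg D₂ D₃ R₂ R₃ j, one_le_pairWt_of_pos D₂ D₃ R₂ R₃⟩

/-- **The node sum of the family** at exponent `μ ≥ 1` (`Re p, Re q > 1`). [cite: ThornerZaman2017, §7.2 (7.7)] -/
theorem hasSum_fam (hp : 1 < p.re) (hq : 1 < q.re) {μ : ℕ} (hμ : 1 ≤ μ) :
    HasSum (fun j ↦ (famWt D₀ D₁ D₂ D₃ R₀ R₁ R₂ R₃ j : ℂ) * famZ D₀ D₁ D₂ D₃ p q j ^ μ)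
      ((2 * (poleInd ψ₀ + poleInd ψ₁) * (((p - 1) ^ (2 * μ))⁻¹ - ((p - β) ^ (2 * μ))⁻¹) -
        (pairLSeries K ψ₀ (2 * μ - 1) p + pairLSeries K ψ₁ (2 * μ - 1) p)) +
       (2 * (poleInd ψ₂ + poleInd ψ₃) * (((q - 1) ^ (2 * μ))⁻¹ - ((q - β) ^ (2 * μ))⁻¹) -
        (pairLSeries K ψ₂ (2 * μ - 1) q + pairLSeries K ψ₃ (2 * μ - 1) q))) := by
  have ha := hasSum_pair D₀ D₁ R₀ R₁ hp hμ
  have hb := hasSum_pair D₂ D₃ R₂ R₃ hq hμ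
  refine HasSum.sum (f := fun j ↦ (famWt D₀ D₁ D₂ D₃ R₀ R₁ R₂ R₃ j : ℂ) * famZ D₀ D₁ D₂ D₃ p q j ^ μ)
    (ha.congr_fun fun j ↦ ?_) (hb.congr_fun fun j ↦ ?_)
  · simp only [Function.comp_apply, famWt, famZ, famPt, famNode, Sum.elim_inl, inv_sq_pow]
  · simp only [Function.comp_apply, famWt, famZ, famPt, famNode, Sum.elim_inr, inv_sq_pow]

/-- **Summability** of `Σ b |z|` and **the `M`-bound** of the family. [cite: ThornerZaman2017, Lemma 7.4] -/
theorem tsum_famWt_mul_norm_le (hp : 1 < p.re) (hq : 1 < q.re) :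
    Summable (fun j ↦ famWt D₀ D₁ D₂ D₃ R₀ R₁ R₂ R₃ j * ‖famZ D₀ D₁ D₂ D₃ p q j‖) ∧
    ∑' j, famWt D₀ D₁ D₂ D₃ R₀ R₁ R₂ R₃ j * ‖famZ D₀ D₁ D₂ D₃ p q j‖ ≤
      ((p.re - 1)⁻¹ * ((2 / p + 2 / (p - 1) + 2 * logDeriv (dedekindGammaFactor K) p).re - (pairLSeries K ψ₀ 0 p).re) +
       (p.re - 1)⁻¹ * ((2 / p + 2 / (p - 1) + 2 * logDeriv (dedekindGammaFactor K) p).re - (pairLSeries K ψ₁ 0 p).re) +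
       4 * Module.finrank ℚ K * zetaTwo) +
      ((q.re - 1)⁻¹ * ((2 / q + 2 / (q - 1) + 2 * logDeriv (dedekindGammaFactor K) q).re - (pairLSeries K ψ₂ 0 q).re) +
       (q.re - 1)⁻¹ * ((2 / q + 2 / (q - 1) + 2 * logDeriv (dedekindGammaFactor K) q).re - (pairLSeries K ψ₃ 0 q).re) +
       4 * Module.finrank ℚ K * zetaTwo) := by
  have hSa := summable_pairWt_mul_norm D₀ D₁ R₀ R₁ hp
  have hSb := summable_pairWt_mul_norm D₂ D₃ R₂ R₃ hq
  have ha := tsum_pairWt_mul_norm_le D₀ D₁ R₀ R₁ hp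
  have hb := tsum_pairWt_mul_norm_le D₂ D₃ R₂ R₃ hq
  have hSa' : Summable ((fun j ↦ famWt D₀ D₁ D₂ D₃ R₀ R₁ R₂ R₃ j * ‖famZ D₀ D₁ D₂ D₃ p q j‖) ∘ Sum.inl) :=
    hSa.congr fun j ↦ rfl
  have hSb' : Summable ((fun j ↦ famWt D₀ D₁ D₂ D₃ R₀ R₁ R₂ R₃ j * ‖famZ D₀ D₁ D₂ D₃ p q j‖) ∘ Sum.inr) :=
    hSb.congr fun j ↦ rfl
  refine ⟨Summable.sum _ hSa' hSb', ?_⟩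
  rw [Summable.tsum_sum hSa' hSb']
  exact add_le_add ha hb

/-- A zero `ρ` of `L(·, ψ₂)` with `Re ρ > 0`, `ρ ∉ {1, 0, β}` is a node of positive weight of the family,
in the second pair. [folklore] -/
theorem exists_fam_idx_of_zero {ρ : ℂ} (hρ0 : 0 < ρ.re) (hρ1 : ρ ≠ 1) (hρβ : ρ ≠ β)
    (hρ : classGroupLFunction K ψ₂ ρ = 0) :
    ∃ j, 0 < famWt D₀ D₁ D₂ D₃ R₀ R₁ R₂ R₃ j ∧ famZ D₀ D₁ D₂ D₃ p q j = ((q - ρ) ^ 2)⁻¹ := by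
  obtain ⟨j, hj, hjv⟩ := exists_pair_idx_of_zero D₂ D₃ R₂ R₃ hρ0 hρ1 hρβ hρ
  exact ⟨Sum.inr j, by simpa [famWt] using hj, by simp [famZ, famPt, famNode, hjv]⟩

end fam

end DH

open DH

/-! ### The theorem -/

/-- Elementary: for `0 ≤ x`, `exp(−2 m x) ≤ ((1 + x)²)^{−m}`. [folklore] -/
theorem exp_neg_le_inv_sq_pow {x : ℝ} (hx : 0 ≤ x) (m : ℕ) :
    Real.exp (-(2 * m * x)) ≤ (((1 + x) ^ 2)⁻¹) ^ m := by
  have h1 : (1 + x) ≤ Real.exp x := by linarith [Real.add_one_le_exp x]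
  have h2 : Real.exp (-(2 * x)) ≤ ((1 + x) ^ 2)⁻¹ := by
    rw [Real.exp_neg, show 2 * x = x + x by ring, Real.exp_add, ← sq]
    exact inv_anti₀ (by positivity) (pow_le_pow_left₀ (by linarith) h1 2)
  calc Real.exp (-(2 * m * x)) = (Real.exp (-(2 * x))) ^ m := by rw [← Real.exp_nat_mul]; ring_nf
    _ ≤ (((1 + x) ^ 2)⁻¹) ^ m := pow_le_pow_left₀ (Real.exp_pos _).le h2 m

/-- The real part of the value of the family: `Re[2(δ+δ')(A − B) − P] = 2(δ+δ') Re(A − B) − Re P`. [folklore] -/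
theorem re_famValue (δ δ' : ℝ) (A B P : ℂ) :
    (2 * ((δ : ℂ) + δ') * (A - B) - P).re = 2 * (δ + δ') * (A - B).re - P.re := by
  rw [sub_re, show (2 * ((δ : ℂ) + δ')) = ((2 * (δ + δ') : ℝ) : ℂ) by push_cast; ring, Complex.re_ofReal_mul]

set_option maxHeartbeats 1600000 in
/-- **The Deuring–Heilbronn phenomenon for class group `L`-functions** (all number fields, pair form of
Lagarias–Montgomery–Odlyzko / Thorner–Zaman): there is an absolute `C > 0` such that for every number
field `K`, every real class group character `χ₁` (`χ₁² = 1`) with `L(β₁, χ₁) = 0`, `0 < β₁ < 1`, every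
class group character `χ` and every zero `ρ` of `L(·, χ)` with `Re ρ ≥ 1/2`, `ρ ≠ 1`, `ρ ≠ β₁`:
`log(1/(C ℒ (1 − β₁)))/(C ℒ) ≤ 1 − Re ρ`, `ℒ = log|d_K| + n_K (log(|Im ρ| + 2) + 1)`.
[cite: ThornerZaman2017, Theorem 1.3 and §7.2] [cite: LagariasMontgomeryOdlyzko1979, Theorem 5.1] -/
theorem deuringHeilbronn :
    ∃ C : ℝ, 0 < C ∧ ∀ (K : Type) [Field K] [NumberField K] (χ₁ : ClassGroup (𝓞 K) →* ℂˣ), χ₁ * χ₁ = 1 →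
      ∀ β₁ : ℝ, 0 < β₁ → β₁ < 1 → classGroupLFunction K χ₁ β₁ = 0 →
      ∀ (χ : ClassGroup (𝓞 K) →* ℂˣ) (ρ : ℂ), classGroupLFunction K χ ρ = 0 → 1 / 2 ≤ ρ.re → ρ ≠ 1 →
        ρ ≠ β₁ →
        Real.log (1 / (C * (Real.log ((discr K).natAbs : ℝ) + Module.finrank ℚ K * (Real.log (|ρ.im| + 2) + 1)) *
            (1 - β₁))) /
          (C * (Real.log ((discr K).natAbs : ℝ) + Module.finrank ℚ K * (Real.log (|ρ.im| + 2) + 1))) ≤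
        1 - ρ.re := by
  obtain ⟨A₀, hA₀, hgam⟩ := exists_re_pole_gamma_le
  have hZ₂ := zetaTwo_nonneg
  -- constants
  set C₁ : ℝ := 36 + 4 * A₀ + 8 * zetaTwo with hC₁
  have hC₁1 : 1 ≤ C₁ := by rw [hC₁]; nlinarith
  refine ⟨49608 * C₁, by positivity, ?_⟩
  intro K _ _ χ₁ h₁ β₁ hβ0 hβ1 hLβ χ ρ hLρ hρre hρ1 hρβ
  -- notation
  set n : ℝ := (Module.finrank ℚ K : ℝ) with hn
  set Ld : ℝ := Real.log ((discr K).natAbs : ℝ) with hLd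
  set t : ℝ := ρ.im with ht
  set ℒ : ℝ := Ld + n * (Real.log (|t| + 2) + 1) with hℒ
  set δ₁ : ℝ := 1 - β₁ with hδ₁
  set C : ℝ := 49608 * C₁ with hC
  have hδ₁0 : 0 < δ₁ := by rw [hδ₁]; linarith
  have hn1 : 1 ≤ n := by rw [hn]; exact_mod_cast Module.finrank_pos
  have hLd0 : 0 ≤ Ld := Real.log_nonneg (by
    exact_mod_cast Nat.one_le_iff_ne_zero.mpr (Int.natAbs_ne_zero.mpr (discr_ne_zero K)))
  have hlog2 : 0 ≤ Real.log (|t| + 2) := Real.log_nonneg (by linarith [abs_nonneg t])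
  have hℒ1 : 1 ≤ ℒ := by rw [hℒ]; nlinarith
  have hℒ0 : 0 < ℒ := by linarith
  have hC0 : 0 < C := by positivity
  -- `Re ρ ≤ 1`, so `x = 1 − Re ρ ≥ 0`
  have hρ0 : 0 < ρ.re := by linarith
  have hΞχρ : classXiPair K χ ρ = 0 := by
    rw [classXiPair, classXi_eq_zero_of_classGroupLFunction_eq_zero χ hρ0 hρ1 hLρ, zero_mul]
  have hρle : ρ.re ≤ 1 := re_le_one_of_classXiPair_eq_zero χ hΞχρ
  set x : ℝ := 1 - ρ.re with hx
  have hx0 : 0 ≤ x := by rw [hx]; linarith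
  -- the trivial case: a negative bound
  have htriv : Real.log (1 / (C * ℒ * δ₁)) < 0 → Real.log (1 / (C * ℒ * δ₁)) / (C * ℒ) ≤ x := fun hneg ↦
    (div_nonpos_of_nonpos_of_nonneg hneg.le (by positivity)).trans hx0
  by_cases hβhalf : β₁ ≤ 1 / 2
  · apply htriv
    rw [one_div, Real.log_inv, neg_lt_zero]
    apply Real.log_pos
    have h49 : (49608 : ℝ) ≤ C := by rw [hC]; nlinarith
    have hδ : 1 / 2 ≤ δ₁ := by rw [hδ₁]; linarith
    have h1 : (49608 : ℝ) * 1 ≤ C * ℒ := mul_le_mul h49 hℒ1 (by norm_num) hC0.le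
    nlinarith [mul_nonneg (sub_nonneg.mpr h1) (sub_nonneg.mpr hδ)]
  push Not at hβhalf
  -- the points `pσ = 2`, `ps = 2 + it`
  set pσ : ℂ := ((2 : ℝ) : ℂ) with hpσ
  set ps : ℂ := ((2 : ℝ) : ℂ) + t * I with hps
  have hpσre : pσ.re = 2 := by simp [hpσ]
  have hpsre : ps.re = 2 := by simp [hps]
  have hpσ1 : 1 < pσ.re := by rw [hpσre]; norm_num
  have hps1 : 1 < ps.re := by rw [hpsre]; norm_num
  -- Hadamard data and removals
  obtain ⟨D₀⟩ := nonempty_symmHadamardData_classXiPair (K := K) 1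
  obtain ⟨D₁⟩ := nonempty_symmHadamardData_classXiPair (K := K) χ₁
  obtain ⟨D₂⟩ := nonempty_symmHadamardData_classXiPair (K := K) χ
  obtain ⟨D₃⟩ := nonempty_symmHadamardData_classXiPair (K := K) (χ₁ * χ)
  have hβhalf' : (β₁ : ℂ) ≠ 1 / 2 := fun h ↦ by
    have := congrArg Complex.re h; simp at this; linarith
  have hβ0' : (β₁ : ℂ) ≠ 0 := by exact_mod_cast hβ0.ne'
  have hβ1' : (β₁ : ℂ) ≠ 1 := by exact_mod_cast hβ1.ne
  have hdouble := classXiPair_double_of_real h₁ hβ0 hβ1.ne hLβ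
  obtain ⟨R₀⟩ := exists_removal D₀ hβhalf' hβ0' hβ1' (χ₁ = 1) (fun h ↦ by subst h; exact hdouble)
  obtain ⟨R₁⟩ := exists_removal D₁ hβhalf' hβ0' hβ1' ((1 : ClassGroup (𝓞 K) →* ℂˣ) = 1) (fun _ ↦ hdouble)
  obtain ⟨R₂⟩ := exists_removal D₂ hβhalf' hβ0' hβ1' (χ₁ * χ = 1) (fun h ↦ by
    have hχ : χ = χ₁ := eq_of_mul_eq_one_of_mul_self h₁ h
    subst hχ; exact hdouble)
  obtain ⟨R₃⟩ := exists_removal D₃ hβhalf' hβ0' hβ1' (χ = 1) (fun h ↦ by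
    subst h; rw [mul_one_char]; exact hdouble)
  -- the family
  set b := famWt D₀ D₁ D₂ D₃ R₀ R₁ R₂ R₃ with hb
  set z := famZ D₀ D₁ D₂ D₃ pσ ps with hz
  have hb0 : ∀ j, 0 ≤ b j := fun j ↦ (famWt_nonneg_and D₀ D₁ D₂ D₃ R₀ R₁ R₂ R₃ j).1
  have hb1 : ∀ j, 0 < b j → 1 ≤ b j := fun j ↦ (famWt_nonneg_and D₀ D₁ D₂ D₃ R₀ R₁ R₂ R₃ j).2
  obtain ⟨hsum, hSle⟩ := tsum_famWt_mul_norm_le D₀ D₁ D₂ D₃ R₀ R₁ R₂ R₃ pσ ps hpσ1 hps1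
  -- the `M`-bound: `Σ b|z| ≤ C₁ ℒ`
  have hGσ : ((2 : ℂ) / pσ + 2 / (pσ - 1) + 2 * logDeriv (dedekindGammaFactor K) pσ).re ≤
      3 + Ld + n * (A₀ + 2 * Real.log (|t| + 2)) := by
    have h := hgam K 0
    have hpt : (2 : ℂ) + (0 : ℝ) * I = pσ := by simp [hpσ]
    rw [hpt] at h
    simp only [abs_zero, zero_add] at h
    have hlog : Real.log 2 ≤ Real.log (|t| + 2) := Real.log_le_log two_pos (by linarith [abs_nonneg t])
    nlinarith [h, mul_nonneg (by linarith : (0:ℝ) ≤ n) (sub_nonneg.mpr hlog)]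
  have hGs : ((2 : ℂ) / ps + 2 / (ps - 1) + 2 * logDeriv (dedekindGammaFactor K) ps).re ≤
      3 + Ld + n * (A₀ + 2 * Real.log (|t| + 2)) := by
    have h := hgam K t
    have hpt : (2 : ℂ) + t * I = ps := by simp [hps]
    rwa [hpt] at h
  have hP0 : 0 ≤ (pairLSeries K 1 0 pσ).re + (pairLSeries K χ₁ 0 pσ).re + (pairLSeries K χ 0 ps).re +
      (pairLSeries K (χ₁ * χ) 0 ps).re := by
    have := re_pairLSeries_sum_nonneg (K := K) h₁ χ (σ := 2) (by norm_num) t 0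
    simpa only [add_re] using this
  have hStot : ∑' j, b j * ‖z j‖ ≤ C₁ * ℒ := by
    have e2 : (pσ.re - 1)⁻¹ = 1 := by rw [hpσre]; norm_num
    have e3 : (ps.re - 1)⁻¹ = 1 := by rw [hpsre]; norm_num
    rw [e2, e3] at hSle
    have hfin : 4 * (3 + Ld + n * (A₀ + 2 * Real.log (|t| + 2))) + 8 * n * zetaTwo ≤ C₁ * ℒ := by
      rw [hC₁, hℒ]
      have h3 : (0:ℝ) ≤ n := by linarith
      nlinarith [mul_nonneg h3 hlog2, mul_nonneg h3 hZ₂, mul_nonneg hA₀ h3, mul_nonneg hZ₂ hLd0,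
        mul_nonneg hZ₂ (mul_nonneg h3 hlog2), mul_nonneg hA₀ hLd0, mul_nonneg hA₀ (mul_nonneg h3 hlog2)]
    have := hSle
    rw [← hn] at this
    linarith
  -- the node of `ρ`
  obtain ⟨j₁, hbj₁, hzj₁⟩ := exists_fam_idx_of_zero D₀ D₁ D₂ D₃ R₀ R₁ R₂ R₃ pσ ps hρ0 hρ1 hρβ hLρ
  have hsub : ps - ρ = ((1 + x : ℝ) : ℂ) := by
    apply Complex.ext <;> simp [hps, hx, ht]; ring
  have h1x : 0 < 1 + x := by linarith
  have hzj₁norm : ‖z j₁‖ = ((1 + x) ^ 2)⁻¹ := by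
    rw [hz, hzj₁, hsub, norm_inv, norm_pow, Complex.norm_real, Real.norm_of_nonneg h1x.le]
  have hzj₁0 : z j₁ ≠ 0 := by rw [← norm_pos_iff, hzj₁norm]; positivity
  -- the maximal node and the power sum inequality
  obtain ⟨j₀, hbj₀, hzj₀, hmax⟩ := PowerSum.exists_max_node z b hb1 hsum hbj₁ hzj₁0
  obtain ⟨m, hm1, hmM, hmain, -⟩ := PowerSum.exists_re_tsum_powerSum_ge z b hb0 hsum hbj₀ hzj₀ hmax one_pos
  rw [(hasSum_fam D₀ D₁ D₂ D₃ R₀ R₁ R₂ R₃ pσ ps hpσ1 hps1 hm1).tsum_eq, add_re, re_famValue, re_famValue]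
    at hmain
  -- upper bound of the value: `≤ 16 m δ₁`
  have hPm : 0 ≤ (pairLSeries K 1 (2 * m - 1) pσ).re + (pairLSeries K χ₁ (2 * m - 1) pσ).re +
      (pairLSeries K χ (2 * m - 1) ps).re + (pairLSeries K (χ₁ * χ) (2 * m - 1) ps).re := by
    have := re_pairLSeries_sum_nonneg (K := K) h₁ χ (σ := 2) (by norm_num) t (2 * m - 1)
    simpa only [add_re] using this
  have hc1 : (((pσ - 1) ^ (2 * m))⁻¹ - ((pσ - β₁) ^ (2 * m))⁻¹).re ≤ 2 * m * δ₁ := by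
    have h := re_inv_pow_sub_inv_pow_le (a := pσ - 1) (by rw [sub_re, hpσre]; norm_num) hδ₁0.le (2 * m)
    have e : pσ - 1 + (δ₁ : ℂ) = pσ - β₁ := by rw [hδ₁]; push_cast; ring
    rw [e] at h; push_cast at h; linarith
  have hc2 : (((ps - 1) ^ (2 * m))⁻¹ - ((ps - β₁) ^ (2 * m))⁻¹).re ≤ 2 * m * δ₁ := by
    have h := re_inv_pow_sub_inv_pow_le (a := ps - 1) (by rw [sub_re, hpsre]; norm_num) hδ₁0.le (2 * m)
    have e : ps - 1 + (δ₁ : ℂ) = ps - β₁ := by rw [hδ₁]; push_cast; ring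
    rw [e] at h; push_cast at h; linarith
  have hp01 := poleInd_nonneg (K := K) (1 : ClassGroup (𝓞 K) →* ℂˣ); have hp1 := poleInd_nonneg (K := K) χ₁
  have hp2 := poleInd_nonneg (K := K) χ; have hp3 := poleInd_nonneg (K := K) (χ₁ * χ)
  have hupper : (1 : ℝ) / (96 + 10 * 1) * b j₀ * ‖z j₀‖ ^ m ≤ 16 * m * δ₁ := by
    have hmδ : 0 ≤ 2 * (m : ℝ) * δ₁ := by positivity
    have w1 := mul_le_mul_of_nonneg_left hc1
      (by linarith : (0:ℝ) ≤ 2 * (poleInd (1 : ClassGroup (𝓞 K) →* ℂˣ) + poleInd χ₁))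
    have w2 := mul_le_mul_of_nonneg_left hc2 (by linarith : (0:ℝ) ≤ 2 * (poleInd χ + poleInd (χ₁ * χ)))
    have w3 : 2 * (poleInd (1 : ClassGroup (𝓞 K) →* ℂˣ) + poleInd χ₁) * (2 * m * δ₁) ≤ 4 * (2 * m * δ₁) :=
      mul_le_mul_of_nonneg_right (by linarith) hmδ
    have w4 : 2 * (poleInd χ + poleInd (χ₁ * χ)) * (2 * m * δ₁) ≤ 4 * (2 * m * δ₁) :=
      mul_le_mul_of_nonneg_right (by linarith) hmδ
    have a1 := add_re (pairLSeries K 1 (2 * m - 1) pσ) (pairLSeries K χ₁ (2 * m - 1) pσ)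
    have a2 := add_re (pairLSeries K χ (2 * m - 1) ps) (pairLSeries K (χ₁ * χ) (2 * m - 1) ps)
    linarith
  -- lower bound: `b j₀ ‖z j₀‖^m ≥ ‖z j₁‖^m ≥ exp(−2 m x)`
  have hzle : ‖z j₁‖ ≤ ‖z j₀‖ := hmax j₁ hbj₁
  have hlow : Real.exp (-(2 * m * x)) ≤ b j₀ * ‖z j₀‖ ^ m := by
    calc Real.exp (-(2 * m * x)) ≤ ‖z j₁‖ ^ m := by rw [hzj₁norm]; exact exp_neg_le_inv_sq_pow hx0 m
      _ ≤ ‖z j₀‖ ^ m := pow_le_pow_left₀ (norm_nonneg _) hzle m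
      _ = 1 * ‖z j₀‖ ^ m := (one_mul _).symm
      _ ≤ b j₀ * ‖z j₀‖ ^ m := mul_le_mul_of_nonneg_right (hb1 j₀ hbj₀) (by positivity)
  -- the quantity `M`
  set S : ℝ := ∑' j, b j * ‖z j‖ with hS
  have hbz₀ : 0 < b j₀ * ‖z j₀‖ := mul_pos hbj₀ (norm_pos_iff.mpr hzj₀)
  set M : ℝ := S / (b j₀ * ‖z j₀‖) with hM
  have hS₀ : b j₀ * ‖z j₀‖ ≤ S := hsum.le_tsum j₀ (fun j _ ↦ mul_nonneg (hb0 j) (norm_nonneg _))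
  have hM1 : 1 ≤ M := by rw [hM, le_div_iff₀ hbz₀, one_mul]; exact hS₀
  have hx12 : x ≤ 1 / 2 := by rw [hx]; linarith
  have hzj₁ge : (4 : ℝ) / 9 ≤ ‖z j₁‖ := by
    rw [hzj₁norm]
    have : (1 + x) ^ 2 ≤ 9 / 4 := by nlinarith
    calc (4 : ℝ) / 9 = (9 / 4 : ℝ)⁻¹ := by norm_num
      _ ≤ ((1 + x) ^ 2)⁻¹ := inv_anti₀ (by positivity) this
  have hbz₀ge : (4 : ℝ) / 9 ≤ b j₀ * ‖z j₀‖ := by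
    calc (4 : ℝ) / 9 ≤ ‖z j₁‖ := hzj₁ge
      _ ≤ ‖z j₀‖ := hzle
      _ = 1 * ‖z j₀‖ := (one_mul _).symm
      _ ≤ b j₀ * ‖z j₀‖ := mul_le_mul_of_nonneg_right (hb1 j₀ hbj₀) (norm_nonneg _)
  set M₁ : ℝ := 9 / 4 * (C₁ * ℒ) with hM₁
  have hMM₁ : M ≤ M₁ := by
    rw [hM, hM₁, div_le_iff₀ hbz₀]
    have hCℒ0 : 0 ≤ C₁ * ℒ := by positivity
    have h1 := mul_le_mul_of_nonneg_left hbz₀ge hCℒ0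
    linarith only [hStot, h1]
  -- combine
  have hm13 : (m : ℝ) ≤ 13 * M := by linarith only [hmM]
  have hkey : Real.exp (-(26 * M * x)) ≤ 22048 * M * δ₁ := by
    have e1 : Real.exp (-(26 * M * x)) ≤ Real.exp (-(2 * m * x)) := by
      apply Real.exp_le_exp.mpr
      have h2m : 2 * (m : ℝ) ≤ 26 * M := by linarith only [hm13]
      have := mul_le_mul_of_nonneg_right h2m hx0
      linarith only [this]
    have e2 : Real.exp (-(2 * m * x)) ≤ 106 * (16 * m * δ₁) := by
      have h106 : (1 : ℝ) / (96 + 10 * 1) * b j₀ * ‖z j₀‖ ^ m = (b j₀ * ‖z j₀‖ ^ m) / 106 := by ring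
      rw [h106, div_le_iff₀ (by norm_num : (0:ℝ) < 106)] at hupper
      linarith only [hupper, hlow]
    have e3 : (106 : ℝ) * (16 * m * δ₁) ≤ 22048 * M * δ₁ := by
      have := mul_le_mul_of_nonneg_right hm13 hδ₁0.le
      linarith only [this]
    linarith only [e1, e2, e3]
  have hfinal := dh_final_step hx0 hM1 hMM₁ hδ₁0 (by norm_num : (0 : ℝ) < 22048) hkey
  have hCℒ : 22048 * M₁ = C * ℒ := by rw [hM₁, hC]; ring
  rw [hCℒ] at hfinal
  by_cases hneg : Real.log (1 / (C * ℒ * δ₁)) < 0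
  · exact htriv hneg
  · push Not at hneg
    calc Real.log (1 / (C * ℒ * δ₁)) / (C * ℒ) ≤ Real.log (1 / (C * ℒ * δ₁)) / (26 * M₁) := by
          apply div_le_div_of_nonneg_left hneg (by positivity)
          rw [hM₁, hC]; nlinarith
      _ ≤ x := hfinal

end Literature.NumberTheory.LFunctions.NumberField

end
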